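/-
Copyright (c) 2026 the pub-hodgecm-mathlib formalisation cell (harness21).  Prover seat hodgecm-mathlib-K2E3-p12 (g2), Track B «K2-LIT» ∕ h413
(`stmt-HodgeConjecture-24833`), line `K2_E3_EllipticInputs`, row 12 (12-S): THE CAPSTONE COMPOSITION — the residual socket U12-d₁ (and the identity cone (12-Id))
FROM the admissibility socket (U12-g), the four LIE-ALGEBRA CORE statements (L-A)∕(L-B) on `𝔤𝔩_N(F)` and on `𝔲(σ_w, H_w)`, and the descent socket (12-D).  2026-09-04.
-/
import Summits.HodgeConjecture.HodgeConjecture.Theorems.K2E3NormalizedCharBddNearSemisimpleOfIdentityDescent  -- ★ p855952 (this seat): `normalizedCharBddOnCayleySlice_of_identity_of_descent`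
import Summits.HodgeConjecture.HodgeConjecture.Theorems.K2E3NormalizedCharBddNearSemisimpleModelTransport   -- ★ p856182 (this seat): brings ★ p856143 `normalizedCharBddNearIdentity_of_split`, ★ p856031 `…_of_nonsplit`, ★ `PlacesOver.nonempty`, ★ `LocalIrrepAdmissible`
import Summits.HodgeConjecture.HodgeConjecture.Theorems.K2E3GLnNormalizedCharBddNearIdentityOfLieCore        -- ★ p856206 (this seat): `normalizedCharBddNearOne_of_lieBound`, `lieBound_of_lieCore` (GL_N over a local field)
import Summits.HodgeConjecture.HodgeConjecture.Theorems.K2E3UNormalizedCharBddNearIdentityOfLieCore          -- ★ p856250 (this seat): `uNormalizedCharBddNearOne_of_lieBound`, `uLieBound_of_lieCore`; brings ★ `K2E3LieUnitaryDefs` (`lieOfForm`, `lieFourier`)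
import Literature.NumberTheory.Automorphic.AdicCompletionLocalField                                            -- ★ instances `ValuativeRel (v.adicCompletion K)`, `IsNonarchimedeanLocalField (v.adicCompletion K)`
import Literature.NumberTheory.Automorphic.AdeleAddCharLocalNontrivial                                         -- ★ `adeleAddCharAt`, `isContinuousNontrivial_adeleAddCharAt` (a non-trivial continuous `ψ_w` exists)
import Literature.NumberTheory.Automorphic.GaloisActionPlaces                                                  -- ★ `galAdicCompletionMap`, `continuous_galAdicCompletionMap`
import HarnessLib

/-!
# K2_E3 road (h413 = stmt-HodgeConjecture-24833), row 12 — U12-d₁ ∕ (12-Id) FROM (U12-g) + THE FOUR LIE-ALGEBRA CORE STATEMENTS + (12-D)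

Cell `pub/hodgecm-mathlib` (D-0151), Track B (21-frontier RULING «PUSH BOTH» 2026-09-03, director req624), seat K2E3-p12 (g2), line lead of row 12 (12-S).
`--supports stmt-HodgeConjecture-24833 --as helper`; THEOREMS ONLY (no definition ∕ instance ∕ notation ∕ named fact ∕ `sorry`); never imports `Cruxes/…/Lines`.

The row-12 structural programme of this seat (★ p855779 … p856258) reduced the residual socket U12-d₁ `sig_K2E3NormalizedCharBddOnCayleySlice` (ED. 5 :214; the
minimal cone of tier-0 `stub_charLocBdd`) to statements at the IDENTITY of the two families of local-FIELD groups.  This file is the capstone: ONE theorem whose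
hypotheses are exactly the hostable sockets and whose conclusion is U12-d₁ byte for byte.

* §1 **`normalizedCharBddNearIdentity_of_lieCore : ‹U12-g› → ‹L-A_GL› → ‹L-B_GL› → ‹L-A_U› → ‹L-B_U› → ‹12-Id›`.**  (12-Id) = «`√√‖u‖·|Θ_π|` bounded near `1`» on
  `U_N(H)(L⁺_v)`, every `N`, every place.  (L-A_GL)∕(L-B_GL): for every non-archimedean local field `F` of characteristic `0`, every `N`, every non-trivial continuous
  `ψ : AddChar F Circle`, every additive Haar measure `μ𝔤` on `𝔤𝔩_N(F) = M_N(F)` — (L-A_GL) «local character expansion at `1` in `T̂`-form through the Cayley chart: for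
  every admissible irreducible `π₀` of `GL_N(F)` and every `Θ₀` locally constant on the regular set representing `χ_{π₀}`, some `T ∈ J(𝒩)` has `Θ₀(c(Y)) = F(Y)` for
  regular `Y` near `0`, for every `F` representing `T̂` locally constant on the regular set»; (L-B_GL) «every `T ∈ J(𝒩)` (an `Ad`-invariant linear functional on
  `C_c^∞(𝔤)` supported on the nilpotent cone) has `T̂ = F_T`, locally integrable, locally constant on the regular set, `√|disc χ_X|_F·|F_T X|` bounded on compacta» —
  VERBATIM the hypotheses `hA`∕`hB` of ★ `lieBound_of_lieCore` (p856206) with `ψ ↦ (ψ · : ℂ)`.  (L-A_U)∕(L-B_U): the same two statements on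
  `𝔲(σ_w, H_w) = ↥(lieOfForm σ_w H_w) ⊂ M_N(L_w)` for the one-place unitary group `U(σ_w, H_w)(L_w)` at a NON-SPLIT place `w ∣ v` of a CM field `L`
  (`σ_w = galAdicCompletionMap c`, `H_w = placeForm H w`, `H` hermitian invertible), weight `√√|disc χ_X|_{L_w}`, Fourier transform ★ `lieFourier` — VERBATIM the
  hypotheses of ★ `uLieBound_of_lieCore` (p856250).  PROOF: admissibility from (U12-g); pick `w ∣ v` (★ `PlacesOver.nonempty`); `ψ := ψ_w` the local component of the
  standard adelic character (★ `adeleAddCharAt`, non-trivial and continuous by ★ `isContinuousNontrivial_adeleAddCharAt`); `μ𝔤 :=` the additive Haar measure `addHaar`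
  of `M_N(L_w)` ∕ of the closed subgroup `𝔲` (★ `isClosed_lieOfForm`, ★ `continuous_galAdicCompletionMap`); `2 ≠ 0` in `L_w ⊇ L ⊇ ℚ`.  Split `w` (`c·w ≠ w`):
  ★ `normalizedCharBddNearIdentity_of_split` (p856143) ∘ ★ `normalizedCharBddNearOne_of_lieBound` ∘ ★ `lieBound_of_lieCore` (p856206).  Non-split `w`:
  ★ `normalizedCharBddNearIdentity_of_nonsplit` (p856031) ∘ ★ `uNormalizedCharBddNearOne_of_lieBound` ∘ ★ `uLieBound_of_lieCore` (p856250).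
* §2 **`normalizedCharBddOnCayleySlice_of_lieCore : ‹U12-g› → ‹L-A_GL› → ‹L-B_GL› → ‹L-A_U› → ‹L-B_U› → ‹12-D› → ‹U12-d₁›`** — the residual socket
  `sig_K2E3NormalizedCharBddOnCayleySlice` VERBATIM as conclusion: §1 fed into ★ `normalizedCharBddOnCayleySlice_of_identity_of_descent` (p855952) together with the
  descent socket (12-D) (non-regular non-central semisimple points; vacuous for `N ≤ 2` — ★ p855904).  The U12-d form (`sig_K2E3NormalizedCharBddNearSemisimple`, :261)
  follows the same way from ★ `normalizedCharBddNearSemisimple_of_identity_of_descent hg (§1 …) hD` (one line for the edition; not restated here to keep the file short).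

So, for the editions: U12-d₁ ⟸ {(U12-g) ★ for `N ≤ 3`; (L-A_GL), (L-B_GL), (L-A_U), (L-B_U) — Harish-Chandra 1999 Thm. 4.4 ∕ Thm. 16.3 + §21 at `γ = 1` (Howe 1974 for `GL_n`),
through the Cayley chart `c(Y) = (1+Y)(1−Y)⁻¹` (an `Ad`-equivariant analytic chart at `0`, tangent to `2·id`; DeBacker 2002 §2.2∕Adler–Korman 2007 work with such
substitutes of `exp`); (12-D) — HC Thm. 16.3 at singular non-central semisimple points, needed from `N = 3` on}.  Nothing in this file is specific to `N`.
HONEST LABEL: HC_CM is proved only modulo the 7 printed citations (2 remaining named inputs: hLiu418 = stmt-HodgeConjecture-24832, h413 = stmt-HodgeConjecture-24833)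
until rung 0 closes; REL ≠ ★ — this file is a composition; the four core statements and (12-D) are NOT proved here.

## References
* [HarishChandra1999AdmissibleDistributions] Harish-Chandra (notes by S. DeBacker and P. J. Sally Jr.), *Admissible Invariant Distributions on Reductive p-adic Groups*,
  ULS 16, AMS (1999): Thm. 4.4 p. 11, Thm. 16.3 p. 77, §21 p. 87.
* [Howe1974] R. Howe, *The Fourier transform and germs of characters (case of Gl_n over a p-adic field)*, Math. Ann. 208 (1974), 305–322.
* [DeBacker2002Homogeneity] S. DeBacker, *Homogeneity results for invariant distributions of a reductive p-adic group*, Ann. Sci. ÉNS 35 (2002), 391–422, §2.2.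
* [CasselsFrohlichANT1967] J. W. S. Cassels, A. Fröhlich (eds.), *Algebraic Number Theory* (1967), Ch. XV (Tate), Lemma 2.2.3 (the local components `ψ_v`).
* [PlatonovRapinchuk1994] V. Platonov, A. Rapinchuk, *Algebraic Groups and Number Theory* (1994), §5.1 (the local models at split ∕ non-split places).
-/

set_option autoImplicit false
set_option linter.dupNamespace false   -- `Summit.HodgeConjecture.HodgeConjecture.…` (D-0017 nested layout; lakefile exemption for Summits)

noncomputable section

open NumberField IsDedekindDomain MeasureTheory Measure Filter Topology Polynomial
open scoped Matrix MatrixGroups NNReal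
open Literature.NumberTheory.Rogawski1990 Literature.NumberTheory.Automorphic Literature.NumberTheory.Automorphic.UnitaryGroup
open Literature.NumberTheory.GaloisRepresentations Literature.NumberTheory.GaloisRepresentations.IsNonarchimedeanLocalField
open Summit.HodgeConjecture.HodgeConjecture.Cruxes.H413.K2E3LieUnitary
open Summit.HodgeConjecture.HodgeConjecture.Cruxes.H413.K2E3NormalizedCharBddNearModelTransport
open Summit.HodgeConjecture.HodgeConjecture.Cruxes.H413.K2E3NormalizedCharBddNearModelTransportSplit
open Summit.HodgeConjecture.HodgeConjecture.Cruxes.H413.K2E3GLnNormalizedCharBddNearIdentityOfLieCore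
open Summit.HodgeConjecture.HodgeConjecture.Cruxes.H413.K2E3UNormalizedCharBddNearIdentityOfLieCore
open Summit.HodgeConjecture.HodgeConjecture.Cruxes.H413.K2E3NormalizedCharBddNearSemisimpleOfIdentityDescent

namespace Summit.HodgeConjecture.HodgeConjecture.Cruxes.H413.K2E3NormalizedCharBddOnCayleySliceOfLieCore

/-! ## §1  (12-Id) at every place from the four Lie-algebra core statements -/

set_option maxHeartbeats 1600000 in
set_option synthInstance.maxHeartbeats 400000 in
open scoped Classical in
/-- **(12-Id) ⟸ (U12-g) + (L-A_GL) + (L-B_GL) + (L-A_U) + (L-B_U)** — `√√‖u‖·|Θ_π|` is bounded near the identity of `U_N(H)(L⁺_v)` (every `N`, every place `v`), from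
admissibility and the local character expansion ∕ Harish-Chandra's Thm. 4.4 on `𝔤𝔩_N(L_w)` (split `w ∣ v`) and on `𝔲(σ_w, H_w)` (non-split `w`).
[cite: HarishChandra1999AdmissibleDistributions, Thm. 4.4 p. 11, Thm. 16.3 p. 77, §21 p. 87] [cite: Howe1974, Prop. 3, Lemma 4] [cite: PlatonovRapinchuk1994, §5.1] -/
theorem normalizedCharBddNearIdentity_of_lieCore
    (hg : ∀ (L : Type) [Field L] [NumberField L] [IsCMField L] (N : ℕ) (H : Matrix (Fin N) (Fin N) L), UnitaryGroup.LocalIrrepAdmissible L N H)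
    (hAGL : ∀ (F : Type) [Field F] [ValuativeRel F] [TopologicalSpace F] [IsNonarchimedeanLocalField F] [CharZero F] (N : ℕ)
      (ψ : AddChar F Circle), ψ.IsContinuousNontrivial →
      ∀ [MeasurableSpace (Matrix (Fin N) (Fin N) F)] [BorelSpace (Matrix (Fin N) (Fin N) F)] (μ𝔤 : Measure (Matrix (Fin N) (Fin N) F)) [μ𝔤.IsAddHaarMeasure]
        [MeasurableSpace (GL (Fin N) F)] [BorelSpace (GL (Fin N) F)] (μ₀ : Measure (GL (Fin N) F)) [μ₀.IsHaarMeasure]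
        (r₀ : SmoothIrrep (GL (Fin N) F)), r₀.ρ.IsAdmissible → ∀ Θ₀ : GL (Fin N) F → ℂ,
        (∀ x₀ : GL (Fin N) F, IsRegularElt x₀ → ∀ᶠ y in 𝓝 x₀, Θ₀ y = Θ₀ x₀) →
        (∀ φ₀ : GL (Fin N) F → ℂ, IsLocSmooth φ₀ → (IrrClass.mk r₀).smoothTrace μ₀ φ₀ = ∫ x, φ₀ x * Θ₀ x ∂μ₀) →
      ∃ V : Set (Matrix (Fin N) (Fin N) F), V ∈ 𝓝 (0 : Matrix (Fin N) (Fin N) F) ∧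
      ∃ T : (Matrix (Fin N) (Fin N) F → ℂ) → ℂ,
        ((∀ f₁ f₂ : Matrix (Fin N) (Fin N) F → ℂ, IsLocSmooth f₁ → IsLocSmooth f₂ → T (f₁ + f₂) = T f₁ + T f₂) ∧
         (∀ (a : ℂ) (f : Matrix (Fin N) (Fin N) F → ℂ), IsLocSmooth f → T (a • f) = a * T f) ∧
         (∀ (x : GL (Fin N) F) (f : Matrix (Fin N) (Fin N) F → ℂ), IsLocSmooth f →
            T (fun X => f ((x : Matrix (Fin N) (Fin N) F) * X * ((x⁻¹ : GL (Fin N) F) : Matrix (Fin N) (Fin N) F))) = T f) ∧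
         (∀ f : Matrix (Fin N) (Fin N) F → ℂ, IsLocSmooth f → (∀ X ∈ tsupport f, ¬ IsNilpotent X) → T f = 0)) ∧
        ∀ Fn : Matrix (Fin N) (Fin N) F → ℂ,
          (∀ f : Matrix (Fin N) (Fin N) F → ℂ, IsLocSmooth f →
              T (fun Y => ∫ X, ((ψ (Matrix.trace (Y * X)) : Circle) : ℂ) * f X ∂μ𝔤) = ∫ X, f X * Fn X ∂μ𝔤) →
          (∀ X : Matrix (Fin N) (Fin N) F, IsUnit X.charpoly.discr → ∀ᶠ Y in 𝓝 X, Fn Y = Fn X) →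
          ∀ g : GL (Fin N) F, ∀ Y ∈ V, IsUnit Y.charpoly.discr → IsUnit (1 - Y) → IsUnit (1 + Y) →
            (g : Matrix (Fin N) (Fin N) F) = (1 + Y) * (1 - Y)⁻¹ → Θ₀ g = Fn Y)
    (hBGL : ∀ (F : Type) [Field F] [ValuativeRel F] [TopologicalSpace F] [IsNonarchimedeanLocalField F] [CharZero F] (N : ℕ)
      (ψ : AddChar F Circle), ψ.IsContinuousNontrivial →
      ∀ [MeasurableSpace (Matrix (Fin N) (Fin N) F)] [BorelSpace (Matrix (Fin N) (Fin N) F)] (μ𝔤 : Measure (Matrix (Fin N) (Fin N) F)) [μ𝔤.IsAddHaarMeasure],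
      ∀ T : (Matrix (Fin N) (Fin N) F → ℂ) → ℂ,
        ((∀ f₁ f₂ : Matrix (Fin N) (Fin N) F → ℂ, IsLocSmooth f₁ → IsLocSmooth f₂ → T (f₁ + f₂) = T f₁ + T f₂) ∧
         (∀ (a : ℂ) (f : Matrix (Fin N) (Fin N) F → ℂ), IsLocSmooth f → T (a • f) = a * T f) ∧
         (∀ (x : GL (Fin N) F) (f : Matrix (Fin N) (Fin N) F → ℂ), IsLocSmooth f →
            T (fun X => f ((x : Matrix (Fin N) (Fin N) F) * X * ((x⁻¹ : GL (Fin N) F) : Matrix (Fin N) (Fin N) F))) = T f) ∧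
         (∀ f : Matrix (Fin N) (Fin N) F → ℂ, IsLocSmooth f → (∀ X ∈ tsupport f, ¬ IsNilpotent X) → T f = 0)) →
        ∃ Fn : Matrix (Fin N) (Fin N) F → ℂ, LocallyIntegrable Fn μ𝔤 ∧
          (∀ f : Matrix (Fin N) (Fin N) F → ℂ, IsLocSmooth f →
              T (fun Y => ∫ X, ((ψ (Matrix.trace (Y * X)) : Circle) : ℂ) * f X ∂μ𝔤) = ∫ X, f X * Fn X ∂μ𝔤) ∧
          (∀ X : Matrix (Fin N) (Fin N) F, IsUnit X.charpoly.discr → ∀ᶠ Y in 𝓝 X, Fn Y = Fn X) ∧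
          (∀ C : Set (Matrix (Fin N) (Fin N) F), IsCompact C → ∃ B : ℝ, ∀ X ∈ C,
              ((NNReal.sqrt (normAbs F X.charpoly.discr) : ℝ≥0) : ℝ) * ‖Fn X‖ ≤ B))
    (hAU : ∀ (L : Type) [Field L] [NumberField L] [IsCMField L] (N : ℕ) (H : Matrix (Fin N) (Fin N) L),
      (H.map (cmConjRingHom L))ᵀ = H → H.det ≠ 0 →
      ∀ (v : HeightOneSpectrum (𝓞 ↥(maximalRealSubfield L))) (w : UnitaryGroup.PlacesOver L v) (hw : IsCMField.complexConj L • w.1 = w.1)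
      (ψ : AddChar (w.1.adicCompletion L) Circle), ψ.IsContinuousNontrivial →
      ∀ [MeasurableSpace ↥(lieOfForm (galAdicCompletionMap (L := L) (IsCMField.complexConj L) hw) (UnitaryGroup.placeForm H w.1))]
        [BorelSpace ↥(lieOfForm (galAdicCompletionMap (L := L) (IsCMField.complexConj L) hw) (UnitaryGroup.placeForm H w.1))]
        (μ𝔤 : Measure ↥(lieOfForm (galAdicCompletionMap (L := L) (IsCMField.complexConj L) hw) (UnitaryGroup.placeForm H w.1))) [μ𝔤.IsAddHaarMeasure]
        [MeasurableSpace ↥(unitaryGroupOfForm (galAdicCompletionMap (L := L) (IsCMField.complexConj L) hw) (UnitaryGroup.placeForm H w.1))]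
        [BorelSpace ↥(unitaryGroupOfForm (galAdicCompletionMap (L := L) (IsCMField.complexConj L) hw) (UnitaryGroup.placeForm H w.1))]
        (μ₀ : Measure ↥(unitaryGroupOfForm (galAdicCompletionMap (L := L) (IsCMField.complexConj L) hw) (UnitaryGroup.placeForm H w.1))) [μ₀.IsHaarMeasure]
        (r₀ : SmoothIrrep ↥(unitaryGroupOfForm (galAdicCompletionMap (L := L) (IsCMField.complexConj L) hw) (UnitaryGroup.placeForm H w.1))), r₀.ρ.IsAdmissible →
        ∀ Θ₀ : ↥(unitaryGroupOfForm (galAdicCompletionMap (L := L) (IsCMField.complexConj L) hw) (UnitaryGroup.placeForm H w.1)) → ℂ,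
        (∀ x₀ : ↥(unitaryGroupOfForm (galAdicCompletionMap (L := L) (IsCMField.complexConj L) hw) (UnitaryGroup.placeForm H w.1)),
          IsRegularElt (x₀ : GL (Fin N) (w.1.adicCompletion L)) → ∀ᶠ y in 𝓝 x₀, Θ₀ y = Θ₀ x₀) →
        (∀ φ₀ : ↥(unitaryGroupOfForm (galAdicCompletionMap (L := L) (IsCMField.complexConj L) hw) (UnitaryGroup.placeForm H w.1)) → ℂ,
          IsLocSmooth φ₀ → (IrrClass.mk r₀).smoothTrace μ₀ φ₀ = ∫ x, φ₀ x * Θ₀ x ∂μ₀) →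
      ∃ V : Set (Matrix (Fin N) (Fin N) (w.1.adicCompletion L)), V ∈ 𝓝 (0 : Matrix (Fin N) (Fin N) (w.1.adicCompletion L)) ∧
      ∃ T : (↥(lieOfForm (galAdicCompletionMap (L := L) (IsCMField.complexConj L) hw) (UnitaryGroup.placeForm H w.1)) → ℂ) → ℂ,
        ((∀ f₁ f₂ : ↥(lieOfForm (galAdicCompletionMap (L := L) (IsCMField.complexConj L) hw) (UnitaryGroup.placeForm H w.1)) → ℂ, IsLocSmooth f₁ → IsLocSmooth f₂ → T (f₁ + f₂) = T f₁ + T f₂) ∧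
         (∀ (a : ℂ) (f : ↥(lieOfForm (galAdicCompletionMap (L := L) (IsCMField.complexConj L) hw) (UnitaryGroup.placeForm H w.1)) → ℂ), IsLocSmooth f → T (a • f) = a * T f) ∧
         (∀ (x : ↥(unitaryGroupOfForm (galAdicCompletionMap (L := L) (IsCMField.complexConj L) hw) (UnitaryGroup.placeForm H w.1))) (f : ↥(lieOfForm (galAdicCompletionMap (L := L) (IsCMField.complexConj L) hw) (UnitaryGroup.placeForm H w.1)) → ℂ), IsLocSmooth f →
            T (fun X => f ⟨((x : GL (Fin N) (w.1.adicCompletion L)) : Matrix (Fin N) (Fin N) (w.1.adicCompletion L)) * X.1 * (((x : GL (Fin N) (w.1.adicCompletion L))⁻¹ : GL (Fin N) (w.1.adicCompletion L)) : Matrix (Fin N) (Fin N) (w.1.adicCompletion L)),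
              conj_mem_lieOfForm x.2 X.2⟩) = T f) ∧
         (∀ f : ↥(lieOfForm (galAdicCompletionMap (L := L) (IsCMField.complexConj L) hw) (UnitaryGroup.placeForm H w.1)) → ℂ, IsLocSmooth f → (∀ X ∈ tsupport f, ¬ IsNilpotent X.1) → T f = 0)) ∧
        ∀ Fn : ↥(lieOfForm (galAdicCompletionMap (L := L) (IsCMField.complexConj L) hw) (UnitaryGroup.placeForm H w.1)) → ℂ,
          (∀ f : ↥(lieOfForm (galAdicCompletionMap (L := L) (IsCMField.complexConj L) hw) (UnitaryGroup.placeForm H w.1)) → ℂ, IsLocSmooth f → T (lieFourier (galAdicCompletionMap (L := L) (IsCMField.complexConj L) hw) (UnitaryGroup.placeForm H w.1) (fun x : w.1.adicCompletion L => ((ψ x : Circle) : ℂ)) μ𝔤 f) = ∫ X, f X * Fn X ∂μ𝔤) →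
          (∀ X : ↥(lieOfForm (galAdicCompletionMap (L := L) (IsCMField.complexConj L) hw) (UnitaryGroup.placeForm H w.1)), IsUnit X.1.charpoly.discr → ∀ᶠ Y in 𝓝 X, Fn Y = Fn X) →
          ∀ g : ↥(unitaryGroupOfForm (galAdicCompletionMap (L := L) (IsCMField.complexConj L) hw) (UnitaryGroup.placeForm H w.1)), ∀ Y : ↥(lieOfForm (galAdicCompletionMap (L := L) (IsCMField.complexConj L) hw) (UnitaryGroup.placeForm H w.1)), Y.1 ∈ V → IsUnit Y.1.charpoly.discr → IsUnit (1 - Y.1) → IsUnit (1 + Y.1) →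
            ((g : GL (Fin N) (w.1.adicCompletion L)) : Matrix (Fin N) (Fin N) (w.1.adicCompletion L)) = (1 + Y.1) * (1 - Y.1)⁻¹ → Θ₀ g = Fn Y)
    (hBU : ∀ (L : Type) [Field L] [NumberField L] [IsCMField L] (N : ℕ) (H : Matrix (Fin N) (Fin N) L),
      (H.map (cmConjRingHom L))ᵀ = H → H.det ≠ 0 →
      ∀ (v : HeightOneSpectrum (𝓞 ↥(maximalRealSubfield L))) (w : UnitaryGroup.PlacesOver L v) (hw : IsCMField.complexConj L • w.1 = w.1)
      (ψ : AddChar (w.1.adicCompletion L) Circle), ψ.IsContinuousNontrivial →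
      ∀ [MeasurableSpace ↥(lieOfForm (galAdicCompletionMap (L := L) (IsCMField.complexConj L) hw) (UnitaryGroup.placeForm H w.1))]
        [BorelSpace ↥(lieOfForm (galAdicCompletionMap (L := L) (IsCMField.complexConj L) hw) (UnitaryGroup.placeForm H w.1))]
        (μ𝔤 : Measure ↥(lieOfForm (galAdicCompletionMap (L := L) (IsCMField.complexConj L) hw) (UnitaryGroup.placeForm H w.1))) [μ𝔤.IsAddHaarMeasure],
      ∀ T : (↥(lieOfForm (galAdicCompletionMap (L := L) (IsCMField.complexConj L) hw) (UnitaryGroup.placeForm H w.1)) → ℂ) → ℂ,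
        ((∀ f₁ f₂ : ↥(lieOfForm (galAdicCompletionMap (L := L) (IsCMField.complexConj L) hw) (UnitaryGroup.placeForm H w.1)) → ℂ, IsLocSmooth f₁ → IsLocSmooth f₂ → T (f₁ + f₂) = T f₁ + T f₂) ∧
         (∀ (a : ℂ) (f : ↥(lieOfForm (galAdicCompletionMap (L := L) (IsCMField.complexConj L) hw) (UnitaryGroup.placeForm H w.1)) → ℂ), IsLocSmooth f → T (a • f) = a * T f) ∧
         (∀ (x : ↥(unitaryGroupOfForm (galAdicCompletionMap (L := L) (IsCMField.complexConj L) hw) (UnitaryGroup.placeForm H w.1))) (f : ↥(lieOfForm (galAdicCompletionMap (L := L) (IsCMField.complexConj L) hw) (UnitaryGroup.placeForm H w.1)) → ℂ), IsLocSmooth f →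
            T (fun X => f ⟨((x : GL (Fin N) (w.1.adicCompletion L)) : Matrix (Fin N) (Fin N) (w.1.adicCompletion L)) * X.1 * (((x : GL (Fin N) (w.1.adicCompletion L))⁻¹ : GL (Fin N) (w.1.adicCompletion L)) : Matrix (Fin N) (Fin N) (w.1.adicCompletion L)),
              conj_mem_lieOfForm x.2 X.2⟩) = T f) ∧
         (∀ f : ↥(lieOfForm (galAdicCompletionMap (L := L) (IsCMField.complexConj L) hw) (UnitaryGroup.placeForm H w.1)) → ℂ, IsLocSmooth f → (∀ X ∈ tsupport f, ¬ IsNilpotent X.1) → T f = 0)) →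
        ∃ Fn : ↥(lieOfForm (galAdicCompletionMap (L := L) (IsCMField.complexConj L) hw) (UnitaryGroup.placeForm H w.1)) → ℂ, LocallyIntegrable Fn μ𝔤 ∧
          (∀ f : ↥(lieOfForm (galAdicCompletionMap (L := L) (IsCMField.complexConj L) hw) (UnitaryGroup.placeForm H w.1)) → ℂ, IsLocSmooth f → T (lieFourier (galAdicCompletionMap (L := L) (IsCMField.complexConj L) hw) (UnitaryGroup.placeForm H w.1) (fun x : w.1.adicCompletion L => ((ψ x : Circle) : ℂ)) μ𝔤 f) = ∫ X, f X * Fn X ∂μ𝔤) ∧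
          (∀ X : ↥(lieOfForm (galAdicCompletionMap (L := L) (IsCMField.complexConj L) hw) (UnitaryGroup.placeForm H w.1)), IsUnit X.1.charpoly.discr → ∀ᶠ Y in 𝓝 X, Fn Y = Fn X) ∧
          (∀ C : Set ↥(lieOfForm (galAdicCompletionMap (L := L) (IsCMField.complexConj L) hw) (UnitaryGroup.placeForm H w.1)), IsCompact C → ∃ B : ℝ, ∀ X ∈ C,
              ((NNReal.sqrt (NNReal.sqrt (normAbs (w.1.adicCompletion L) X.1.charpoly.discr)) : ℝ≥0) : ℝ) * ‖Fn X‖ ≤ B)) :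
    ∀ (L : Type) [Field L] [NumberField L] [IsCMField L] (N : ℕ) (H : Matrix (Fin N) (Fin N) L),
      (H.map (cmConjRingHom L))ᵀ = H → H.det ≠ 0 →
      ∀ (v : HeightOneSpectrum (𝓞 ↥(maximalRealSubfield L)))
        [MeasurableSpace ((UnitaryGroup.cmDatum L N H).Local v)] [BorelSpace ((UnitaryGroup.cmDatum L N H).Local v)]
        (μ : Measure ((UnitaryGroup.cmDatum L N H).Local v)) [μ.IsHaarMeasure]
        (c : IrrClass ((UnitaryGroup.cmDatum L N H).Local v)) (Θ : (UnitaryGroup.cmDatum L N H).Local v → ℂ),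
        LocallyIntegrable Θ μ →
        (∀ x : (UnitaryGroup.cmDatum L N H).Local v,
          IsRegularElt (x.val : GL (Fin N) (UnitaryGroup.LocalRing L v)) → ∀ᶠ y in 𝓝 x, Θ y = Θ x) →
        (∀ φ : (UnitaryGroup.cmDatum L N H).Local v → ℂ, IsLocSmooth φ → c.smoothTrace μ φ = ∫ x, φ x * Θ x ∂μ) →
        ∃ U : Set ((UnitaryGroup.cmDatum L N H).Local v), IsOpen U ∧ (1 : (UnitaryGroup.cmDatum L N H).Local v) ∈ U ∧
        ∃ B : ℝ, ∀ g ∈ U, ∀ u : (UnitaryGroup.LocalRing L v)ˣ,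
          (u : UnitaryGroup.LocalRing L v) *
              (((g.val : GL (Fin N) (UnitaryGroup.LocalRing L v)).val : Matrix (Fin N) (Fin N) (UnitaryGroup.LocalRing L v)).det) ^ (N - 1) =
            (((g.val : GL (Fin N) (UnitaryGroup.LocalRing L v)).val : Matrix (Fin N) (Fin N) (UnitaryGroup.LocalRing L v)).charpoly).discr →
          ((NNReal.sqrt (NNReal.sqrt (unitModulusChar (UnitaryGroup.LocalRing L v) u)) : ℝ≥0) : ℝ) * ‖Θ g‖ ≤ B := by
  intro L _ _ _ N H hH hHd v _ _ μ _ c Θ _ hloc hrep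
  have hadm : c.IsAdmissible := hg L N H hH (isUnit_iff_ne_zero.2 hHd) v c
  obtain ⟨w⟩ := (inferInstance : Nonempty (UnitaryGroup.PlacesOver L v))
  haveI : CharZero (w.1.adicCompletion L) := charZero_of_injective_algebraMap (algebraMap L (w.1.adicCompletion L)).injective
  have h2 : (2 : w.1.adicCompletion L) ≠ 0 := two_ne_zero
  -- the local component `ψ_w` of the standard adelic additive character: continuous and non-trivial
  have hψ := isContinuousNontrivial_adeleAddCharAt L w.1
  haveI : LocallyCompactSpace (Matrix (Fin N) (Fin N) (w.1.adicCompletion L)) :=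
    inferInstanceAs (LocallyCompactSpace (Fin N → Fin N → w.1.adicCompletion L))
  by_cases hw : IsCMField.complexConj L • w.1 = w.1
  · -- NON-SPLIT place: the one-place unitary model `U(σ_w, H_w)(L_w)` and its Lie algebra `𝔲 = ↥(lieOfForm σ_w H_w)`
    refine normalizedCharBddNearIdentity_of_nonsplit L N H v w hw (fun μ₀ _ r₀ hr₀ Θ₀ hl₀ hr₀' => ?_) μ c hadm Θ hloc hrep
    have hσ : Continuous (galAdicCompletionMap (L := L) (IsCMField.complexConj L) hw) :=
      continuous_galAdicCompletionMap (L := L) (IsCMField.complexConj L) hw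
    letI : MeasurableSpace ↥(lieOfForm (galAdicCompletionMap (L := L) (IsCMField.complexConj L) hw) (UnitaryGroup.placeForm H w.1)) := borel _
    haveI : BorelSpace ↥(lieOfForm (galAdicCompletionMap (L := L) (IsCMField.complexConj L) hw) (UnitaryGroup.placeForm H w.1)) := ⟨rfl⟩
    haveI : LocallyCompactSpace ↥(lieOfForm (galAdicCompletionMap (L := L) (IsCMField.complexConj L) hw) (UnitaryGroup.placeForm H w.1)) :=
      (Topology.IsClosedEmbedding.subtypeVal
        (isClosed_lieOfForm (σ := galAdicCompletionMap (L := L) (IsCMField.complexConj L) hw) (J := UnitaryGroup.placeForm H w.1) hσ)).locallyCompactSpace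
    exact uNormalizedCharBddNearOne_of_lieBound _ _ h2 Θ₀
      (uLieBound_of_lieCore _ _ hσ Measure.addHaar (fun x : w.1.adicCompletion L => ((adeleAddCharAt L w.1 x : Circle) : ℂ)) Θ₀
        (hAU L N H hH hHd v w hw (adeleAddCharAt L w.1) hψ Measure.addHaar μ₀ r₀ hr₀ Θ₀ hl₀ hr₀')
        (hBU L N H hH hHd v w hw (adeleAddCharAt L w.1) hψ Measure.addHaar))
  · -- SPLIT place: the model `GL_N(L_w)` and its Lie algebra `𝔤𝔩_N(L_w) = M_N(L_w)`
    refine normalizedCharBddNearIdentity_of_split L N H v hH hHd w hw (fun μ₀ _ r₀ hr₀ Θ₀ hl₀ hr₀' => ?_) μ c hadm Θ hloc hrep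
    letI : MeasurableSpace (Matrix (Fin N) (Fin N) (w.1.adicCompletion L)) := borel _
    haveI : BorelSpace (Matrix (Fin N) (Fin N) (w.1.adicCompletion L)) := ⟨rfl⟩
    exact normalizedCharBddNearOne_of_lieBound h2 Θ₀
      (lieBound_of_lieCore Measure.addHaar (fun x : w.1.adicCompletion L => ((adeleAddCharAt L w.1 x : Circle) : ℂ)) Θ₀
        (hAGL (w.1.adicCompletion L) N (adeleAddCharAt L w.1) hψ Measure.addHaar μ₀ r₀ hr₀ Θ₀ hl₀ hr₀')
        (hBGL (w.1.adicCompletion L) N (adeleAddCharAt L w.1) hψ Measure.addHaar))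

/-! ## §2  The residual socket U12-d₁ from the four Lie-algebra core statements and the descent socket -/

set_option maxHeartbeats 1600000 in
set_option synthInstance.maxHeartbeats 400000 in
open scoped Classical in
/-- **SOCKET U12-d₁ ⟸ (U12-g) + (L-A_GL) + (L-B_GL) + (L-A_U) + (L-B_U) + (12-D)** — `sig_K2E3NormalizedCharBddOnCayleySlice` (ED. 5 :214) VERBATIM as conclusion:
§1 and the descent socket fed into ★ `normalizedCharBddOnCayleySlice_of_identity_of_descent` (p855952).
[cite: HarishChandra1999AdmissibleDistributions, Thm. 4.4 p. 11, Thm. 16.3 p. 77, §21 p. 87] [cite: Howe1974, Prop. 3, Lemma 4] -/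
theorem normalizedCharBddOnCayleySlice_of_lieCore
    (hg : ∀ (L : Type) [Field L] [NumberField L] [IsCMField L] (N : ℕ) (H : Matrix (Fin N) (Fin N) L), UnitaryGroup.LocalIrrepAdmissible L N H)
    (hAGL : ∀ (F : Type) [Field F] [ValuativeRel F] [TopologicalSpace F] [IsNonarchimedeanLocalField F] [CharZero F] (N : ℕ)
      (ψ : AddChar F Circle), ψ.IsContinuousNontrivial →
      ∀ [MeasurableSpace (Matrix (Fin N) (Fin N) F)] [BorelSpace (Matrix (Fin N) (Fin N) F)] (μ𝔤 : Measure (Matrix (Fin N) (Fin N) F)) [μ𝔤.IsAddHaarMeasure]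
        [MeasurableSpace (GL (Fin N) F)] [BorelSpace (GL (Fin N) F)] (μ₀ : Measure (GL (Fin N) F)) [μ₀.IsHaarMeasure]
        (r₀ : SmoothIrrep (GL (Fin N) F)), r₀.ρ.IsAdmissible → ∀ Θ₀ : GL (Fin N) F → ℂ,
        (∀ x₀ : GL (Fin N) F, IsRegularElt x₀ → ∀ᶠ y in 𝓝 x₀, Θ₀ y = Θ₀ x₀) →
        (∀ φ₀ : GL (Fin N) F → ℂ, IsLocSmooth φ₀ → (IrrClass.mk r₀).smoothTrace μ₀ φ₀ = ∫ x, φ₀ x * Θ₀ x ∂μ₀) →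
      ∃ V : Set (Matrix (Fin N) (Fin N) F), V ∈ 𝓝 (0 : Matrix (Fin N) (Fin N) F) ∧
      ∃ T : (Matrix (Fin N) (Fin N) F → ℂ) → ℂ,
        ((∀ f₁ f₂ : Matrix (Fin N) (Fin N) F → ℂ, IsLocSmooth f₁ → IsLocSmooth f₂ → T (f₁ + f₂) = T f₁ + T f₂) ∧
         (∀ (a : ℂ) (f : Matrix (Fin N) (Fin N) F → ℂ), IsLocSmooth f → T (a • f) = a * T f) ∧
         (∀ (x : GL (Fin N) F) (f : Matrix (Fin N) (Fin N) F → ℂ), IsLocSmooth f →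
            T (fun X => f ((x : Matrix (Fin N) (Fin N) F) * X * ((x⁻¹ : GL (Fin N) F) : Matrix (Fin N) (Fin N) F))) = T f) ∧
         (∀ f : Matrix (Fin N) (Fin N) F → ℂ, IsLocSmooth f → (∀ X ∈ tsupport f, ¬ IsNilpotent X) → T f = 0)) ∧
        ∀ Fn : Matrix (Fin N) (Fin N) F → ℂ,
          (∀ f : Matrix (Fin N) (Fin N) F → ℂ, IsLocSmooth f →
              T (fun Y => ∫ X, ((ψ (Matrix.trace (Y * X)) : Circle) : ℂ) * f X ∂μ𝔤) = ∫ X, f X * Fn X ∂μ𝔤) →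
          (∀ X : Matrix (Fin N) (Fin N) F, IsUnit X.charpoly.discr → ∀ᶠ Y in 𝓝 X, Fn Y = Fn X) →
          ∀ g : GL (Fin N) F, ∀ Y ∈ V, IsUnit Y.charpoly.discr → IsUnit (1 - Y) → IsUnit (1 + Y) →
            (g : Matrix (Fin N) (Fin N) F) = (1 + Y) * (1 - Y)⁻¹ → Θ₀ g = Fn Y)
    (hBGL : ∀ (F : Type) [Field F] [ValuativeRel F] [TopologicalSpace F] [IsNonarchimedeanLocalField F] [CharZero F] (N : ℕ)
      (ψ : AddChar F Circle), ψ.IsContinuousNontrivial →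
      ∀ [MeasurableSpace (Matrix (Fin N) (Fin N) F)] [BorelSpace (Matrix (Fin N) (Fin N) F)] (μ𝔤 : Measure (Matrix (Fin N) (Fin N) F)) [μ𝔤.IsAddHaarMeasure],
      ∀ T : (Matrix (Fin N) (Fin N) F → ℂ) → ℂ,
        ((∀ f₁ f₂ : Matrix (Fin N) (Fin N) F → ℂ, IsLocSmooth f₁ → IsLocSmooth f₂ → T (f₁ + f₂) = T f₁ + T f₂) ∧
         (∀ (a : ℂ) (f : Matrix (Fin N) (Fin N) F → ℂ), IsLocSmooth f → T (a • f) = a * T f) ∧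
         (∀ (x : GL (Fin N) F) (f : Matrix (Fin N) (Fin N) F → ℂ), IsLocSmooth f →
            T (fun X => f ((x : Matrix (Fin N) (Fin N) F) * X * ((x⁻¹ : GL (Fin N) F) : Matrix (Fin N) (Fin N) F))) = T f) ∧
         (∀ f : Matrix (Fin N) (Fin N) F → ℂ, IsLocSmooth f → (∀ X ∈ tsupport f, ¬ IsNilpotent X) → T f = 0)) →
        ∃ Fn : Matrix (Fin N) (Fin N) F → ℂ, LocallyIntegrable Fn μ𝔤 ∧
          (∀ f : Matrix (Fin N) (Fin N) F → ℂ, IsLocSmooth f →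
              T (fun Y => ∫ X, ((ψ (Matrix.trace (Y * X)) : Circle) : ℂ) * f X ∂μ𝔤) = ∫ X, f X * Fn X ∂μ𝔤) ∧
          (∀ X : Matrix (Fin N) (Fin N) F, IsUnit X.charpoly.discr → ∀ᶠ Y in 𝓝 X, Fn Y = Fn X) ∧
          (∀ C : Set (Matrix (Fin N) (Fin N) F), IsCompact C → ∃ B : ℝ, ∀ X ∈ C,
              ((NNReal.sqrt (normAbs F X.charpoly.discr) : ℝ≥0) : ℝ) * ‖Fn X‖ ≤ B))
    (hAU : ∀ (L : Type) [Field L] [NumberField L] [IsCMField L] (N : ℕ) (H : Matrix (Fin N) (Fin N) L),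
      (H.map (cmConjRingHom L))ᵀ = H → H.det ≠ 0 →
      ∀ (v : HeightOneSpectrum (𝓞 ↥(maximalRealSubfield L))) (w : UnitaryGroup.PlacesOver L v) (hw : IsCMField.complexConj L • w.1 = w.1)
      (ψ : AddChar (w.1.adicCompletion L) Circle), ψ.IsContinuousNontrivial →
      ∀ [MeasurableSpace ↥(lieOfForm (galAdicCompletionMap (L := L) (IsCMField.complexConj L) hw) (UnitaryGroup.placeForm H w.1))]
        [BorelSpace ↥(lieOfForm (galAdicCompletionMap (L := L) (IsCMField.complexConj L) hw) (UnitaryGroup.placeForm H w.1))]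
        (μ𝔤 : Measure ↥(lieOfForm (galAdicCompletionMap (L := L) (IsCMField.complexConj L) hw) (UnitaryGroup.placeForm H w.1))) [μ𝔤.IsAddHaarMeasure]
        [MeasurableSpace ↥(unitaryGroupOfForm (galAdicCompletionMap (L := L) (IsCMField.complexConj L) hw) (UnitaryGroup.placeForm H w.1))]
        [BorelSpace ↥(unitaryGroupOfForm (galAdicCompletionMap (L := L) (IsCMField.complexConj L) hw) (UnitaryGroup.placeForm H w.1))]
        (μ₀ : Measure ↥(unitaryGroupOfForm (galAdicCompletionMap (L := L) (IsCMField.complexConj L) hw) (UnitaryGroup.placeForm H w.1))) [μ₀.IsHaarMeasure]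
        (r₀ : SmoothIrrep ↥(unitaryGroupOfForm (galAdicCompletionMap (L := L) (IsCMField.complexConj L) hw) (UnitaryGroup.placeForm H w.1))), r₀.ρ.IsAdmissible →
        ∀ Θ₀ : ↥(unitaryGroupOfForm (galAdicCompletionMap (L := L) (IsCMField.complexConj L) hw) (UnitaryGroup.placeForm H w.1)) → ℂ,
        (∀ x₀ : ↥(unitaryGroupOfForm (galAdicCompletionMap (L := L) (IsCMField.complexConj L) hw) (UnitaryGroup.placeForm H w.1)),
          IsRegularElt (x₀ : GL (Fin N) (w.1.adicCompletion L)) → ∀ᶠ y in 𝓝 x₀, Θ₀ y = Θ₀ x₀) →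
        (∀ φ₀ : ↥(unitaryGroupOfForm (galAdicCompletionMap (L := L) (IsCMField.complexConj L) hw) (UnitaryGroup.placeForm H w.1)) → ℂ,
          IsLocSmooth φ₀ → (IrrClass.mk r₀).smoothTrace μ₀ φ₀ = ∫ x, φ₀ x * Θ₀ x ∂μ₀) →
      ∃ V : Set (Matrix (Fin N) (Fin N) (w.1.adicCompletion L)), V ∈ 𝓝 (0 : Matrix (Fin N) (Fin N) (w.1.adicCompletion L)) ∧
      ∃ T : (↥(lieOfForm (galAdicCompletionMap (L := L) (IsCMField.complexConj L) hw) (UnitaryGroup.placeForm H w.1)) → ℂ) → ℂ,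
        ((∀ f₁ f₂ : ↥(lieOfForm (galAdicCompletionMap (L := L) (IsCMField.complexConj L) hw) (UnitaryGroup.placeForm H w.1)) → ℂ, IsLocSmooth f₁ → IsLocSmooth f₂ → T (f₁ + f₂) = T f₁ + T f₂) ∧
         (∀ (a : ℂ) (f : ↥(lieOfForm (galAdicCompletionMap (L := L) (IsCMField.complexConj L) hw) (UnitaryGroup.placeForm H w.1)) → ℂ), IsLocSmooth f → T (a • f) = a * T f) ∧
         (∀ (x : ↥(unitaryGroupOfForm (galAdicCompletionMap (L := L) (IsCMField.complexConj L) hw) (UnitaryGroup.placeForm H w.1))) (f : ↥(lieOfForm (galAdicCompletionMap (L := L) (IsCMField.complexConj L) hw) (UnitaryGroup.placeForm H w.1)) → ℂ), IsLocSmooth f →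
            T (fun X => f ⟨((x : GL (Fin N) (w.1.adicCompletion L)) : Matrix (Fin N) (Fin N) (w.1.adicCompletion L)) * X.1 * (((x : GL (Fin N) (w.1.adicCompletion L))⁻¹ : GL (Fin N) (w.1.adicCompletion L)) : Matrix (Fin N) (Fin N) (w.1.adicCompletion L)),
              conj_mem_lieOfForm x.2 X.2⟩) = T f) ∧
         (∀ f : ↥(lieOfForm (galAdicCompletionMap (L := L) (IsCMField.complexConj L) hw) (UnitaryGroup.placeForm H w.1)) → ℂ, IsLocSmooth f → (∀ X ∈ tsupport f, ¬ IsNilpotent X.1) → T f = 0)) ∧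
        ∀ Fn : ↥(lieOfForm (galAdicCompletionMap (L := L) (IsCMField.complexConj L) hw) (UnitaryGroup.placeForm H w.1)) → ℂ,
          (∀ f : ↥(lieOfForm (galAdicCompletionMap (L := L) (IsCMField.complexConj L) hw) (UnitaryGroup.placeForm H w.1)) → ℂ, IsLocSmooth f → T (lieFourier (galAdicCompletionMap (L := L) (IsCMField.complexConj L) hw) (UnitaryGroup.placeForm H w.1) (fun x : w.1.adicCompletion L => ((ψ x : Circle) : ℂ)) μ𝔤 f) = ∫ X, f X * Fn X ∂μ𝔤) →
          (∀ X : ↥(lieOfForm (galAdicCompletionMap (L := L) (IsCMField.complexConj L) hw) (UnitaryGroup.placeForm H w.1)), IsUnit X.1.charpoly.discr → ∀ᶠ Y in 𝓝 X, Fn Y = Fn X) →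
          ∀ g : ↥(unitaryGroupOfForm (galAdicCompletionMap (L := L) (IsCMField.complexConj L) hw) (UnitaryGroup.placeForm H w.1)), ∀ Y : ↥(lieOfForm (galAdicCompletionMap (L := L) (IsCMField.complexConj L) hw) (UnitaryGroup.placeForm H w.1)), Y.1 ∈ V → IsUnit Y.1.charpoly.discr → IsUnit (1 - Y.1) → IsUnit (1 + Y.1) →
            ((g : GL (Fin N) (w.1.adicCompletion L)) : Matrix (Fin N) (Fin N) (w.1.adicCompletion L)) = (1 + Y.1) * (1 - Y.1)⁻¹ → Θ₀ g = Fn Y)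
    (hBU : ∀ (L : Type) [Field L] [NumberField L] [IsCMField L] (N : ℕ) (H : Matrix (Fin N) (Fin N) L),
      (H.map (cmConjRingHom L))ᵀ = H → H.det ≠ 0 →
      ∀ (v : HeightOneSpectrum (𝓞 ↥(maximalRealSubfield L))) (w : UnitaryGroup.PlacesOver L v) (hw : IsCMField.complexConj L • w.1 = w.1)
      (ψ : AddChar (w.1.adicCompletion L) Circle), ψ.IsContinuousNontrivial →
      ∀ [MeasurableSpace ↥(lieOfForm (galAdicCompletionMap (L := L) (IsCMField.complexConj L) hw) (UnitaryGroup.placeForm H w.1))]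
        [BorelSpace ↥(lieOfForm (galAdicCompletionMap (L := L) (IsCMField.complexConj L) hw) (UnitaryGroup.placeForm H w.1))]
        (μ𝔤 : Measure ↥(lieOfForm (galAdicCompletionMap (L := L) (IsCMField.complexConj L) hw) (UnitaryGroup.placeForm H w.1))) [μ𝔤.IsAddHaarMeasure],
      ∀ T : (↥(lieOfForm (galAdicCompletionMap (L := L) (IsCMField.complexConj L) hw) (UnitaryGroup.placeForm H w.1)) → ℂ) → ℂ,
        ((∀ f₁ f₂ : ↥(lieOfForm (galAdicCompletionMap (L := L) (IsCMField.complexConj L) hw) (UnitaryGroup.placeForm H w.1)) → ℂ, IsLocSmooth f₁ → IsLocSmooth f₂ → T (f₁ + f₂) = T f₁ + T f₂) ∧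
         (∀ (a : ℂ) (f : ↥(lieOfForm (galAdicCompletionMap (L := L) (IsCMField.complexConj L) hw) (UnitaryGroup.placeForm H w.1)) → ℂ), IsLocSmooth f → T (a • f) = a * T f) ∧
         (∀ (x : ↥(unitaryGroupOfForm (galAdicCompletionMap (L := L) (IsCMField.complexConj L) hw) (UnitaryGroup.placeForm H w.1))) (f : ↥(lieOfForm (galAdicCompletionMap (L := L) (IsCMField.complexConj L) hw) (UnitaryGroup.placeForm H w.1)) → ℂ), IsLocSmooth f →
            T (fun X => f ⟨((x : GL (Fin N) (w.1.adicCompletion L)) : Matrix (Fin N) (Fin N) (w.1.adicCompletion L)) * X.1 * (((x : GL (Fin N) (w.1.adicCompletion L))⁻¹ : GL (Fin N) (w.1.adicCompletion L)) : Matrix (Fin N) (Fin N) (w.1.adicCompletion L)),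
              conj_mem_lieOfForm x.2 X.2⟩) = T f) ∧
         (∀ f : ↥(lieOfForm (galAdicCompletionMap (L := L) (IsCMField.complexConj L) hw) (UnitaryGroup.placeForm H w.1)) → ℂ, IsLocSmooth f → (∀ X ∈ tsupport f, ¬ IsNilpotent X.1) → T f = 0)) →
        ∃ Fn : ↥(lieOfForm (galAdicCompletionMap (L := L) (IsCMField.complexConj L) hw) (UnitaryGroup.placeForm H w.1)) → ℂ, LocallyIntegrable Fn μ𝔤 ∧
          (∀ f : ↥(lieOfForm (galAdicCompletionMap (L := L) (IsCMField.complexConj L) hw) (UnitaryGroup.placeForm H w.1)) → ℂ, IsLocSmooth f → T (lieFourier (galAdicCompletionMap (L := L) (IsCMField.complexConj L) hw) (UnitaryGroup.placeForm H w.1) (fun x : w.1.adicCompletion L => ((ψ x : Circle) : ℂ)) μ𝔤 f) = ∫ X, f X * Fn X ∂μ𝔤) ∧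
          (∀ X : ↥(lieOfForm (galAdicCompletionMap (L := L) (IsCMField.complexConj L) hw) (UnitaryGroup.placeForm H w.1)), IsUnit X.1.charpoly.discr → ∀ᶠ Y in 𝓝 X, Fn Y = Fn X) ∧
          (∀ C : Set ↥(lieOfForm (galAdicCompletionMap (L := L) (IsCMField.complexConj L) hw) (UnitaryGroup.placeForm H w.1)), IsCompact C → ∃ B : ℝ, ∀ X ∈ C,
              ((NNReal.sqrt (NNReal.sqrt (normAbs (w.1.adicCompletion L) X.1.charpoly.discr)) : ℝ≥0) : ℝ) * ‖Fn X‖ ≤ B))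
    (hD : ∀ (L : Type) [Field L] [NumberField L] [IsCMField L] (N : ℕ) (H : Matrix (Fin N) (Fin N) L),
      (H.map (cmConjRingHom L))ᵀ = H → H.det ≠ 0 →
      ∀ (v : HeightOneSpectrum (𝓞 ↥(maximalRealSubfield L)))
        [MeasurableSpace ((UnitaryGroup.cmDatum L N H).Local v)] [BorelSpace ((UnitaryGroup.cmDatum L N H).Local v)]
        (μ : Measure ((UnitaryGroup.cmDatum L N H).Local v)) [μ.IsHaarMeasure]
        (c : IrrClass ((UnitaryGroup.cmDatum L N H).Local v)) (Θ : (UnitaryGroup.cmDatum L N H).Local v → ℂ),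
        LocallyIntegrable Θ μ →
        (∀ x : (UnitaryGroup.cmDatum L N H).Local v,
          IsRegularElt (x.val : GL (Fin N) (UnitaryGroup.LocalRing L v)) → ∀ᶠ y in 𝓝 x, Θ y = Θ x) →
        (∀ φ : (UnitaryGroup.cmDatum L N H).Local v → ℂ, IsLocSmooth φ → c.smoothTrace μ φ = ∫ x, φ x * Θ x ∂μ) →
      ∀ s : (UnitaryGroup.cmDatum L N H).Local v, Module.End.IsSemisimple (Matrix.toLin' ((s.val : GL (Fin N) (UnitaryGroup.LocalRing L v)).val : Matrix (Fin N) (Fin N) (UnitaryGroup.LocalRing L v))) →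
        ¬ IsRegularElt (s.val : GL (Fin N) (UnitaryGroup.LocalRing L v)) → s ∉ Subgroup.center ((UnitaryGroup.cmDatum L N H).Local v) →
        ∃ U : Set ((UnitaryGroup.cmDatum L N H).Local v), IsOpen U ∧ s ∈ U ∧
        ∃ B : ℝ, ∀ g ∈ U, ∀ u : (UnitaryGroup.LocalRing L v)ˣ,
          (u : UnitaryGroup.LocalRing L v) *
              (((g.val : GL (Fin N) (UnitaryGroup.LocalRing L v)).val : Matrix (Fin N) (Fin N) (UnitaryGroup.LocalRing L v)).det) ^ (N - 1) =
            (((g.val : GL (Fin N) (UnitaryGroup.LocalRing L v)).val : Matrix (Fin N) (Fin N) (UnitaryGroup.LocalRing L v)).charpoly).discr →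
          ((NNReal.sqrt (NNReal.sqrt (unitModulusChar (UnitaryGroup.LocalRing L v) u)) : ℝ≥0) : ℝ) * ‖Θ g‖ ≤ B) :
    ∀ (L : Type) [Field L] [NumberField L] [IsCMField L] (N : ℕ) (H : Matrix (Fin N) (Fin N) L),
      (H.map (cmConjRingHom L))ᵀ = H → H.det ≠ 0 →
      ∀ (v : HeightOneSpectrum (𝓞 ↥(maximalRealSubfield L)))
        [MeasurableSpace ((UnitaryGroup.cmDatum L N H).Local v)] [BorelSpace ((UnitaryGroup.cmDatum L N H).Local v)]
        (μ : Measure ((UnitaryGroup.cmDatum L N H).Local v)) [μ.IsHaarMeasure]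
        (c : IrrClass ((UnitaryGroup.cmDatum L N H).Local v)) (Θ : (UnitaryGroup.cmDatum L N H).Local v → ℂ),
        LocallyIntegrable Θ μ →
        (∀ x : (UnitaryGroup.cmDatum L N H).Local v,
          IsRegularElt (x.val : GL (Fin N) (UnitaryGroup.LocalRing L v)) → ∀ᶠ y in 𝓝 x, Θ y = Θ x) →
        (∀ φ : (UnitaryGroup.cmDatum L N H).Local v → ℂ, IsLocSmooth φ → c.smoothTrace μ φ = ∫ x, φ x * Θ x ∂μ) →
      ∀ s : (UnitaryGroup.cmDatum L N H).Local v, Module.End.IsSemisimple (Matrix.toLin' ((s.val : GL (Fin N) (UnitaryGroup.LocalRing L v)).val : Matrix (Fin N) (Fin N) (UnitaryGroup.LocalRing L v))) →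
        ∃ V : Set (Matrix (Fin N) (Fin N) (UnitaryGroup.LocalRing L v)), V ∈ 𝓝 (0 : Matrix (Fin N) (Fin N) (UnitaryGroup.LocalRing L v)) ∧
        ∃ B : ℝ, ∀ y : (UnitaryGroup.cmDatum L N H).Local v,
          (∃ Y ∈ V, (Y.map (UnitaryGroup.conjLocal L (IsCMField.complexConj L) v))ᵀ * ((UnitaryGroup.adelicForm L N H).map (UnitaryGroup.adeleToLocal L v)) = -(((UnitaryGroup.adelicForm L N H).map (UnitaryGroup.adeleToLocal L v)) * Y) ∧
            ((s.val : GL (Fin N) (UnitaryGroup.LocalRing L v)).val : Matrix (Fin N) (Fin N) (UnitaryGroup.LocalRing L v)) * Y = Y * ((s.val : GL (Fin N) (UnitaryGroup.LocalRing L v)).val : Matrix (Fin N) (Fin N) (UnitaryGroup.LocalRing L v)) ∧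
            IsUnit (1 - Y) ∧ IsUnit (1 + Y) ∧
            ((y.val : GL (Fin N) (UnitaryGroup.LocalRing L v)).val : Matrix (Fin N) (Fin N) (UnitaryGroup.LocalRing L v)) = ((s.val : GL (Fin N) (UnitaryGroup.LocalRing L v)).val : Matrix (Fin N) (Fin N) (UnitaryGroup.LocalRing L v)) * ((1 + Y) * (1 - Y)⁻¹)) →
          ∀ u : (UnitaryGroup.LocalRing L v)ˣ,
          (u : UnitaryGroup.LocalRing L v) *
              (((y.val : GL (Fin N) (UnitaryGroup.LocalRing L v)).val : Matrix (Fin N) (Fin N) (UnitaryGroup.LocalRing L v)).det) ^ (N - 1) =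
            (((y.val : GL (Fin N) (UnitaryGroup.LocalRing L v)).val : Matrix (Fin N) (Fin N) (UnitaryGroup.LocalRing L v)).charpoly).discr →
          ((NNReal.sqrt (NNReal.sqrt (unitModulusChar (UnitaryGroup.LocalRing L v) u)) : ℝ≥0) : ℝ) * ‖Θ y‖ ≤ B :=
  normalizedCharBddOnCayleySlice_of_identity_of_descent hg (normalizedCharBddNearIdentity_of_lieCore hg hAGL hBGL hAU hBU) hD

end Summit.HodgeConjecture.HodgeConjecture.Cruxes.H413.K2E3NormalizedCharBddOnCayleySliceOfLieCore

end
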